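/-
COR-CM (cell pub-hodgecm2, stage 2 of the Hodge ladder) — count-neutral KERNEL COMBINATORICS «field level of the SYLOW TRANSFER, IV: a Galois CM field
of degree NOT divisible by 16 contains an imaginary quadratic field iff complex conjugation is not the square of an automorphism» (seat
prover-pub-hodgecm2-b23-g51-0, binder prover b23, gen 51; own census lane SYLOW TRANSFER, claim HOME/INBOX.md l.23329, blanket `CorCM/FaceSylowTransfer*`
l.23357).  Theorems only; `Census/SylowTransferSquare.lean` (this seat), gen 40ʼs dictionary `CorCM/FaceComplementImaginaryQuadratic.lean` and gen 39ʼs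
`CorCM/FaceAbelianImaginaryQuadratic.lean` are used BY NAME; nothing asserted.  `Interfaces.lean` (C1), every E term, B01, `Transposition/*`, `PortJoin/*`,
`D2Bridge/*` untouched.
HONEST FRAMING: `HC_CM` is NOT proved, here or anywhere in the tree; this file produces no period and proves no face period for any field.
T5: n/a-class (hypothesis binders: `16 ∤ [F:ℚ]`, the conjugation automorphism at `σ₀`; checker: self, 2026-08-25).
-/
import Summits.HodgeConjecture.CorCM.Census.SylowTransferSquare
import Summits.HodgeConjecture.CorCM.FaceSylowTransfer
import HarnessLib

/-!
# Field level of the Sylow transfer, IV: imaginary quadratic subfields and square roots of complex conjugation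

Seat b23 gen 39 (`FaceAbelian.not_isSquare_conjAut_iff_exists_imaginary_quadratic_subfield`) needed `Aut(F)` COMMUTATIVE.  For `16 ∤ [F:ℚ]` the
commutativity is superfluous (**`exists_imaginary_quadratic_subfield_iff_not_isSquare_conjAut`**): a Galois CM field of degree not divisible by
`16` contains an imaginary quadratic field iff complex conjugation (the automorphism `c₀` with `σ₀ ∘ c₀ = σ̄₀`) is NOT the square of an automorphism
(`Census/SylowTransferSquare.lean`: a Sylow `2`-subgroup has order `≤ 8`, where the Frattini subgroup is the set of squares; a non-abelian Sylow of
order `8` makes `c₀` a square).  E.g. every Galois CM field of degree `8·odd` whose Galois group contains `Q₈` or `D₄` with complex conjugation in its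
centre has NO imaginary quadratic subfield; every one with `c₀` a non-square has one, and then EXACTLY `β(F) − 1 − δ` generating faces (gen 40).
`HC_CM` is NOT proved.

## References
* [Shimura1998] G. Shimura, Abelian Varieties with Complex Multiplication and Modular Functions, §8.1 (p. 62).
* [Pohlmann1968] H. Pohlmann, Algebraic cycles on abelian varieties of complex multiplication type, Ann. of Math. 88 (1968), Thm 1.
-/

noncomputable section

open NumberField NumberField.ComplexEmbedding

namespace Summit.HodgeConjecture.CorCM.FaceSylowTransfer

open Summit.HodgeConjecture.CorCM.Prior.AllgGroup.RfwfAllgGroup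
open Summit.HodgeConjecture.CorCM.Census
open Summit.HodgeConjecture.CorCM.FaceCensus.OddSlice (galTOfAut galTOfAut_mul galTOfAut_conjAut)

variable {F : Type} [Field F] [NumberField F]

/-- Squares of complex conjugation transport along `Aut(F) ≃ GalT F`: `c₀` is a square in `Aut(F)` iff `conjT` is a square in the Galois
translates. [folklore] -/
theorem isSquare_conjAut_iff [IsGalois ℚ F] (σ₀ : F →+* ℂ) {c₀ : F ≃ₐ[ℚ] F} (hc₀ : σ₀.comp (c₀ : F →+* F) = conjugate σ₀) :
    IsSquare c₀ ↔ ∃ g : GalT F, g * g = conjT := by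
  set e : (F ≃ₐ[ℚ] F) ≃* GalT F := MulEquiv.mk' (galTOfAut σ₀) (galTOfAut_mul σ₀) with he
  have hec : e c₀ = conjT := by rw [he]; exact galTOfAut_conjAut σ₀ hc₀
  constructor
  · rintro ⟨r, hr⟩
    exact ⟨e r, by rw [← map_mul, ← hr, hec]⟩
  · rintro ⟨g, hg⟩
    refine ⟨e.symm g, e.injective ?_⟩
    rw [map_mul, e.apply_symm_apply, hg, hec]

/-- **A GALOIS CM FIELD OF DEGREE NOT DIVISIBLE BY `16` CONTAINS AN IMAGINARY QUADRATIC FIELD IFF COMPLEX CONJUGATION IS NOT THE SQUARE OF AN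
AUTOMORPHISM** (no commutativity; `c₀` the automorphism inducing complex conjugation at `σ₀`). [cite: Shimura1998, §8.1 (p. 62)] -/
theorem exists_imaginary_quadratic_subfield_iff_not_isSquare_conjAut [IsCMField F] [IsGalois ℚ F] (h16 : ¬ 16 ∣ Module.finrank ℚ F)
    (σ₀ : F →+* ℂ) {c₀ : F ≃ₐ[ℚ] F} (hc₀ : σ₀.comp (c₀ : F →+* F) = conjugate σ₀) :
    (∃ E : IntermediateField ℚ F, Module.finrank ℚ E = 2 ∧ ∃ x ∈ E, (σ₀ x).im ≠ 0) ↔ ¬ IsSquare c₀ := by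
  rw [← FaceComplement.exists_cpl_iff_exists_imaginary_quadratic_subfield σ₀, isSquare_conjAut_iff σ₀ hc₀]
  exact SylowTransfer.exists_cpl_iff_not_sq conjT (by rwa [FaceCensus.card_galT (F := F)]) conjT_mul_self conjT_ne_one FaceBasis.conjT_comm

/-- **… hence, for `16 ∤ [F:ℚ]` and complex conjugation a non-square, EXACTLY `β(F) − 1 − δ` = `φ₂(F)` generating faces** (gen 40ʼs complemented law
at field level, `FaceComplement.isLeast_card_faces_hgen_of_imaginary_quadratic_subfield_even/odd` are the block-currency forms; here the `φ₂` form).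
[folklore] -/
theorem isLeast_card_faces_hgen_of_not_isSquare_conjAut [IsCMField F] [IsGalois ℚ F] (h16 : ¬ 16 ∣ Module.finrank ℚ F) (σ₀ : F →+* ℂ)
    {c₀ : F ≃ₐ[ℚ] F} (hc₀ : σ₀.comp (c₀ : F →+* F) = conjugate σ₀) (hns : ¬ IsSquare c₀) :
    IsLeast {n : ℕ | ∃ 𝒮 : Finset (Face F), 𝒮.card = n ∧
      ∀ f : Face F, lefChar f.corner (fun _ => ({σ₀} : Finset (F →+* ℂ))) ∈ AddSubgroup.closure
        {a : Asym F | ∃ g ∈ (𝒮 : Set (Face F)), ∃ σ : F →+* ℂ, a = lefChar g.corner (fun _ => ({σ} : Finset (F →+* ℂ)))}}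
      (Coinvariant.fibreTwo (conjT : GalT F) conjT_mul_self) := by
  have hns' : ∀ g : GalT F, g * g ≠ conjT := fun g hg => hns ((isSquare_conjAut_iff σ₀ hc₀).mpr ⟨g, hg⟩)
  refine FaceTransfer.isLeast_card_faces_hgen_of_intrinsic _ ?_ (fun S₀ hS₀ hS => ?_) σ₀
  · obtain ⟨S, hS, hcard, hgen⟩ := (SylowTransfer.isLeast_card_gfaces_generate_fibreTwo_of_not_sq conjT
      (by rwa [FaceCensus.card_galT (F := F)]) hns' conjT_mul_self conjT_ne_one FaceBasis.conjT_comm).1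
    exact ⟨S, hS, hcard.le, hgen⟩
  · exact Coinvariant.fibreTwo_le_card conjT conjT_mul_self FaceBasis.conjT_comm S₀ (Submodule.span ℤ (Coinvariant.pairSet conjT)) le_rfl hS₀
      (fun y hy => hS (Coinvariant.gfaceSet_subset_hodgeSpan conjT conjT_mul_self hy))

end Summit.HodgeConjecture.CorCM.FaceSylowTransfer
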